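import Literature.Barriers.ABC.BakerMethodBoundsKummerArchProofs
import HarnessLib

/-!
# Cijsouw–Waldschmidt 1977, Lemma 10 over `ℚ`: a Liouville inequality in `ℚ(√α₁, …, √αₖ)`

Support file (theorems and plain definitions only, no named fact) for the proof of
Cijsouw–Waldschmidt 1977, Proposition 1 over `ℚ` with `p = 2` (the archimedean input of
`Literature.Barriers.ABC.BakerMethodBounds`, see `BakerMethodBoundsKummerArchSymmProofs.lean`).

In Step 2 of that proof the values `φ_{J,(τ)}(s/2)` of the auxiliary functions are elements of the
multiquadratic field `ℚ(√α₁, …, √αₖ)`, written on the monomials `∏_{j ∈ S} √αⱼ` with rational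
coefficients of controlled denominator and size, and Lemma 10 (p. 188) is the Liouville estimate
"either `φ(s/p) = 0` or `|φ(s/p)| ≥ exp(−c₁₀ ν^{2n+3} U)`", there obtained from the height of an
algebraic number of degree `≤ D pⁿ`. Here we prove it for `K = ℚ`, `p = 2` WITHOUT number fields,
for coefficient vectors `c : Finset (Fin k) → ℚ` and `ev α c = ∑_S c_S ∏_{j∈S} √αⱼ`:

* `CW77.abs_ev_ge`: if the square classes of the positive rationals `αⱼ` are `𝔽₂`-independent
  (no non-empty sub-product is a square — the `2`-Kummer condition), `c ≠ 0`, `D c_S ∈ ℤ` for all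
  `S`, and `∑_S |c_S| ≤ M` (`M ≥ 1`), then
  `|ev α c| ≥ (2 D M P)^{-4^{k+1}}`, `P = ∏ⱼ max(|num αⱼ|, den αⱼ)`.

Proof by induction on `k` (the last generator `a = αₖ`): `x = ev c = u + v√a` with `u = ev c₀`,
`v = ev c₁` over the first `k` generators; if `c₁ = 0` use the induction hypothesis for `u`;
otherwise `x̄ = u − v√a ≠ 0` by the linear independence of the monomials
(`Literature.Barriers.ABC.linearIndependent_prod_sqrt`), `x x̄ = u² − a v² = ev(c₀ * c₀ − a · c₁ * c₁)`
for the convolution product `*` of coefficient vectors (`ev` is multiplicative: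
`Literature.Barriers.ABC.prod_sqrt_mul_prod_sqrt`), whose denominator and `ℓ¹`-norm are
controlled, so `|x| = |u² − av²| / |x̄| ≥ (induction hypothesis) / (|u| + √a |v|)`.

## References

* [CijsouwWaldschmidt1977] P. L. Cijsouw, M. Waldschmidt, *Linear forms and simultaneous
  approximations*, Compositio Math. 34 (1977), 173–197 — Lemma 10 (p. 188) and p. 189
  ("Using our assumption `[K(α₁^{1/p}, …, αₙ^{1/p}) : K] = pⁿ`, we can express `φ_{J,(τ)}(s/p)` on
  the basis …").
-/

noncomputable section

open Finset Real

namespace Literature.NumberTheory.Transcendental.CW77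

variable {k : ℕ}

/-! ### Monomials, evaluation, convolution -/

/-- The square-root monomial `∏_{j ∈ S} √αⱼ`. [cite: CijsouwWaldschmidt1977, p. 189] -/
def mono (α : Fin k → ℚ) (S : Finset (Fin k)) : ℝ := ∏ j ∈ S, Real.sqrt (α j : ℝ)

/-- Evaluation of a coefficient vector: `ev α c = ∑_S c_S ∏_{j∈S} √αⱼ`. [cite: CijsouwWaldschmidt1977, p. 189] -/
def ev (α : Fin k → ℚ) (c : Finset (Fin k) → ℚ) : ℝ := ∑ S, (c S : ℝ) * mono α S

/-- The convolution product of coefficient vectors, representing the product in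
`ℚ(√α₁, …, √αₖ)`: `(c * d)_U = ∑_{S Δ T = U} (∏_{j ∈ S ∩ T} αⱼ) c_S d_T`. [folklore] -/
def cmul (α : Fin k → ℚ) (c d : Finset (Fin k) → ℚ) : Finset (Fin k) → ℚ := fun U =>
  ∑ S, ∑ T, if symmDiff S T = U then (∏ j ∈ S ∩ T, α j) * (c S * d T) else 0

/-- `0 ≤ ∏_{j∈S} √αⱼ`. [folklore] -/
theorem mono_nonneg (α : Fin k → ℚ) (S : Finset (Fin k)) : 0 ≤ mono α S :=
  Finset.prod_nonneg fun _ _ => Real.sqrt_nonneg _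

/-- `ev` is `ℚ`-linear: additivity. [folklore] -/
theorem ev_add (α : Fin k → ℚ) (c d : Finset (Fin k) → ℚ) :
    ev α (c + d) = ev α c + ev α d := by
  unfold ev; rw [← Finset.sum_add_distrib]
  refine Finset.sum_congr rfl fun S _ => ?_
  simp only [Pi.add_apply, Rat.cast_add]; ring

/-- `ev` is `ℚ`-linear: subtraction. [folklore] -/
theorem ev_sub (α : Fin k → ℚ) (c d : Finset (Fin k) → ℚ) :
    ev α (c - d) = ev α c - ev α d := by
  unfold ev; rw [← Finset.sum_sub_distrib]
  refine Finset.sum_congr rfl fun S _ => ?_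
  simp only [Pi.sub_apply, Rat.cast_sub]; ring

/-- `ev` is `ℚ`-linear: scalars. [folklore] -/
theorem ev_smul (α : Fin k → ℚ) (q : ℚ) (c : Finset (Fin k) → ℚ) :
    ev α (q • c) = (q : ℝ) * ev α c := by
  unfold ev; rw [Finset.mul_sum]
  refine Finset.sum_congr rfl fun S _ => ?_
  simp only [Pi.smul_apply, smul_eq_mul, Rat.cast_mul]; ring

/-- `ev α 0 = 0`. [folklore] -/
theorem ev_zero (α : Fin k → ℚ) : ev α 0 = 0 := by
  unfold ev; simp

/-- **`ev` is multiplicative for the convolution product** (from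
`(∏_S √αⱼ)(∏_T √αⱼ) = (∏_{S∩T} αⱼ) ∏_{SΔT} √αⱼ`). [folklore] -/
theorem ev_cmul (α : Fin k → ℚ) (hα : ∀ j, 0 ≤ α j) (c d : Finset (Fin k) → ℚ) :
    ev α (cmul α c d) = ev α c * ev α d := by
  classical
  unfold ev cmul
  -- expand the right-hand side
  rw [Finset.sum_mul_sum]
  -- the left-hand side: push `mono U` inside and swap sums
  have lhs : ∑ U, ((∑ S, ∑ T, (if symmDiff S T = U then (∏ j ∈ S ∩ T, α j) * (c S * d T) else 0) : ℚ) : ℝ) *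
      mono α U = ∑ S, ∑ T, ((∏ j ∈ S ∩ T, α j : ℚ) : ℝ) * (c S * d T) * mono α (symmDiff S T) := by
    simp only [Rat.cast_sum, Finset.sum_mul]
    rw [Finset.sum_comm]
    refine Finset.sum_congr rfl fun S _ => ?_
    rw [Finset.sum_comm]
    refine Finset.sum_congr rfl fun T _ => ?_
    rw [Finset.sum_eq_single (symmDiff S T)]
    · simp
    · intro U _ hU; rw [if_neg (Ne.symm hU)]; simp
    · intro h; exact absurd (Finset.mem_univ _) h
  rw [lhs]
  refine Finset.sum_congr rfl fun S _ => Finset.sum_congr rfl fun T _ => ?_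
  have key := Literature.Barriers.ABC.prod_sqrt_mul_prod_sqrt α hα S T
  unfold mono
  calc ((∏ j ∈ S ∩ T, α j : ℚ) : ℝ) * ((c S : ℝ) * (d T : ℝ)) * ∏ j ∈ symmDiff S T, Real.sqrt (α j : ℝ)
      = ((c S : ℝ) * (d T : ℝ)) * (((∏ j ∈ S ∩ T, α j : ℚ) : ℝ) * ∏ j ∈ symmDiff S T, Real.sqrt (α j : ℝ)) := by
        ring
    _ = ((c S : ℝ) * (d T : ℝ)) * ((∏ j ∈ S, Real.sqrt (α j : ℝ)) * ∏ j ∈ T, Real.sqrt (α j : ℝ)) := by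
        rw [key]
    _ = (c S : ℝ) * (∏ j ∈ S, Real.sqrt (α j : ℝ)) * ((d T : ℝ) * ∏ j ∈ T, Real.sqrt (α j : ℝ)) := by
        ring

/-! ### Sizes and denominators -/

/-- A product of reals `≥ 1` is `≥ 1`. [folklore] -/
theorem one_le_prod_of_one_le {ι : Type*} (s : Finset ι) (f : ι → ℝ) (h : ∀ i ∈ s, 1 ≤ f i) :
    1 ≤ ∏ i ∈ s, f i :=
  Finset.prod_induction f (fun x => 1 ≤ x) (fun _ _ ha hb => one_le_mul_of_one_le_of_one_le ha hb)
    le_rfl h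

/-- A sub-product of factors `≥ 1`... : `∏_{j ∈ S} f j ≤ ∏ⱼ f j` when `0 ≤ f` on `S` and `1 ≤ f`
off `S`. [folklore] -/
theorem prod_le_univ_prod {ι : Type*} [Fintype ι] [DecidableEq ι] (S : Finset ι) (f : ι → ℝ)
    (h0 : ∀ i, 0 ≤ f i) (h1 : ∀ i, 1 ≤ f i) : ∏ i ∈ S, f i ≤ ∏ i, f i := by
  rw [← Finset.prod_mul_prod_compl S f]
  exact le_mul_of_one_le_right (Finset.prod_nonneg fun i _ => h0 i)
    (one_le_prod_of_one_le _ f fun i _ => h1 i)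

/-- `∏_{j∈S} √αⱼ ≤ ∏ⱼ max(1, √αⱼ)`. [folklore] -/
theorem mono_le (α : Fin k → ℚ) (S : Finset (Fin k)) :
    mono α S ≤ ∏ j, max 1 (Real.sqrt (α j : ℝ)) := by
  classical
  unfold mono
  calc ∏ j ∈ S, Real.sqrt (α j : ℝ) ≤ ∏ j ∈ S, max 1 (Real.sqrt (α j : ℝ)) :=
        Finset.prod_le_prod (fun j _ => Real.sqrt_nonneg _) fun j _ => le_max_right _ _
    _ ≤ ∏ j, max 1 (Real.sqrt (α j : ℝ)) :=
        prod_le_univ_prod S _ (fun j => by positivity) fun j => le_max_left _ _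

/-- `|ev α c| ≤ (∑_S |c_S|) · ∏ⱼ max(1, √αⱼ)`. [folklore] -/
theorem abs_ev_le (α : Fin k → ℚ) (c : Finset (Fin k) → ℚ) :
    |ev α c| ≤ (∑ S, |(c S : ℝ)|) * ∏ j, max 1 (Real.sqrt (α j : ℝ)) := by
  unfold ev
  rw [Finset.sum_mul]
  refine (Finset.abs_sum_le_sum_abs _ _).trans (Finset.sum_le_sum fun S _ => ?_)
  rw [abs_mul, abs_of_nonneg (mono_nonneg α S)]
  exact mul_le_mul_of_nonneg_left (mono_le α S) (abs_nonneg _)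

/-- `|∏_{j ∈ S ∩ T} αⱼ| ≤ ∏ⱼ max(1, |αⱼ|)`. [folklore] -/
theorem abs_prod_inter_le (α : Fin k → ℚ) (S T : Finset (Fin k)) :
    |((∏ j ∈ S ∩ T, α j : ℚ) : ℝ)| ≤ ∏ j, max 1 |(α j : ℝ)| := by
  classical
  push_cast
  rw [Finset.abs_prod]
  calc ∏ j ∈ S ∩ T, |(α j : ℝ)| ≤ ∏ j ∈ S ∩ T, max 1 |(α j : ℝ)| :=
        Finset.prod_le_prod (fun j _ => abs_nonneg _) fun j _ => le_max_right _ _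
    _ ≤ ∏ j, max 1 |(α j : ℝ)| :=
        prod_le_univ_prod _ _ (fun j => by positivity) fun j => le_max_left _ _

/-- **`ℓ¹`-norm of a convolution product**: `∑_U |(c*d)_U| ≤ (∏ⱼ max(1,|αⱼ|)) (∑|c_S|)(∑|d_T|)`. [folklore] -/
theorem l1_cmul_le (α : Fin k → ℚ) (c d : Finset (Fin k) → ℚ) :
    ∑ U, |(cmul α c d U : ℝ)| ≤
      (∏ j, max 1 |(α j : ℝ)|) * ((∑ S, |(c S : ℝ)|) * ∑ T, |(d T : ℝ)|) := by
  classical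
  unfold cmul
  calc ∑ U, |((∑ S, ∑ T, (if symmDiff S T = U then (∏ j ∈ S ∩ T, α j) * (c S * d T) else 0) : ℚ) : ℝ)|
      ≤ ∑ U, ∑ S, ∑ T, |((if symmDiff S T = U then (∏ j ∈ S ∩ T, α j) * (c S * d T) else 0 : ℚ) : ℝ)| := by
        refine Finset.sum_le_sum fun U _ => ?_
        push_cast
        refine (Finset.abs_sum_le_sum_abs _ _).trans (Finset.sum_le_sum fun S _ => ?_)
        exact Finset.abs_sum_le_sum_abs _ _
    _ = ∑ S, ∑ T, |((∏ j ∈ S ∩ T, α j : ℚ) : ℝ)| * (|(c S : ℝ)| * |(d T : ℝ)|) := by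
        rw [Finset.sum_comm]
        refine Finset.sum_congr rfl fun S _ => ?_
        rw [Finset.sum_comm]
        refine Finset.sum_congr rfl fun T _ => ?_
        rw [Finset.sum_eq_single (symmDiff S T)]
        · rw [if_pos rfl]; push_cast; rw [abs_mul, abs_mul]
        · intro U _ hU; rw [if_neg (Ne.symm hU)]; simp
        · intro h; exact absurd (Finset.mem_univ _) h
    _ ≤ ∑ S, ∑ T, (∏ j, max 1 |(α j : ℝ)|) * (|(c S : ℝ)| * |(d T : ℝ)|) := by
        refine Finset.sum_le_sum fun S _ => Finset.sum_le_sum fun T _ => ?_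
        exact mul_le_mul_of_nonneg_right (abs_prod_inter_le α S T) (by positivity)
    _ = (∏ j, max 1 |(α j : ℝ)|) * ((∑ S, |(c S : ℝ)|) * ∑ T, |(d T : ℝ)|) := by
        rw [Finset.sum_mul_sum, Finset.mul_sum]
        refine Finset.sum_congr rfl fun S _ => ?_
        rw [Finset.mul_sum]

/-- The product of the denominators clears every sub-product: `(∏ⱼ den αⱼ) · ∏_{j∈V} αⱼ ∈ ℤ`. [folklore] -/
theorem exists_int_prod_den_mul_prod (α : Fin k → ℚ) (V : Finset (Fin k)) :
    ∃ z : ℤ, ((∏ j, (α j).den : ℕ) : ℚ) * ∏ j ∈ V, α j = z := by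
  classical
  refine ⟨(∏ j ∈ V, (α j).num) * ∏ j ∈ univ \ V, ((α j).den : ℤ), ?_⟩
  have hsplit : ((∏ j, (α j).den : ℕ) : ℚ) = (∏ j ∈ V, ((α j).den : ℚ)) * ∏ j ∈ univ \ V, ((α j).den : ℚ) := by
    push_cast
    rw [← Finset.prod_union (Finset.disjoint_sdiff), Finset.union_sdiff_of_subset (Finset.subset_univ V)]
  rw [hsplit]
  have hV : (∏ j ∈ V, ((α j).den : ℚ)) * ∏ j ∈ V, α j = ((∏ j ∈ V, (α j).num : ℤ) : ℚ) := by
    rw [← Finset.prod_mul_distrib]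
    push_cast
    refine Finset.prod_congr rfl fun j _ => ?_
    rw [mul_comm]; exact Rat.mul_den_eq_num (α j)
  push_cast
  calc (∏ j ∈ V, ((α j).den : ℚ)) * (∏ j ∈ univ \ V, ((α j).den : ℚ)) * ∏ j ∈ V, α j
      = ((∏ j ∈ V, ((α j).den : ℚ)) * ∏ j ∈ V, α j) * ∏ j ∈ univ \ V, ((α j).den : ℚ) := by ring
    _ = (∏ j ∈ V, ((α j).num : ℚ)) * ∏ j ∈ univ \ V, ((α j).den : ℚ) := by
        rw [hV]; push_cast; rfl

/-- **Denominators of a convolution product**: if `Dc · c_S ∈ ℤ` and `Dd · d_T ∈ ℤ` for all `S, T`,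
then `(Dc Dd ∏ⱼ den αⱼ) · (c*d)_U ∈ ℤ`. [folklore] -/
theorem exists_int_cmul (α : Fin k → ℚ) (c d : Finset (Fin k) → ℚ) {Dc Dd : ℕ}
    (hc : ∀ S, ∃ z : ℤ, (Dc : ℚ) * c S = z) (hd : ∀ T, ∃ z : ℤ, (Dd : ℚ) * d T = z)
    (U : Finset (Fin k)) :
    ∃ z : ℤ, ((Dc * Dd * ∏ j, (α j).den : ℕ) : ℚ) * cmul α c d U = z := by
  classical
  unfold cmul
  rw [Finset.mul_sum]
  simp_rw [Finset.mul_sum]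
  -- each term is an integer
  have hterm : ∀ S T, ∃ z : ℤ, ((Dc * Dd * ∏ j, (α j).den : ℕ) : ℚ) *
      (if symmDiff S T = U then (∏ j ∈ S ∩ T, α j) * (c S * d T) else 0) = z := by
    intro S T
    split_ifs
    · obtain ⟨z₁, hz₁⟩ := hc S
      obtain ⟨z₂, hz₂⟩ := hd T
      obtain ⟨z₃, hz₃⟩ := exists_int_prod_den_mul_prod α (S ∩ T)
      refine ⟨z₃ * z₁ * z₂, ?_⟩
      push_cast
      calc ((Dc : ℚ) * Dd * ∏ j, ((α j).den : ℚ)) * ((∏ j ∈ S ∩ T, α j) * (c S * d T))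
          = ((∏ j, ((α j).den : ℚ)) * ∏ j ∈ S ∩ T, α j) * ((Dc : ℚ) * c S) * ((Dd : ℚ) * d T) := by ring
        _ = (z₃ : ℚ) * z₁ * z₂ := by
            rw [hz₁, hz₂, ← hz₃]; push_cast; ring
    · exact ⟨0, by simp⟩
  choose z hz using hterm
  refine ⟨∑ S, ∑ T, z S T, ?_⟩
  push_cast
  refine Finset.sum_congr rfl fun S _ => Finset.sum_congr rfl fun T _ => ?_
  have := hz S T
  push_cast at this
  exact this

/-! ### The naive height product -/

/-- `H(αⱼ) = max(|num αⱼ|, den αⱼ)` and `P(α) = ∏ⱼ H(αⱼ)` (as reals). [folklore] -/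
def hgt (q : ℚ) : ℝ := ((max q.num.natAbs q.den : ℕ) : ℝ)

/-- `P(α) = ∏ⱼ max(|num αⱼ|, den αⱼ)`. [folklore] -/
def heightProd (α : Fin k → ℚ) : ℝ := ∏ j, hgt (α j)

/-- `1 ≤ H(q)`. [folklore] -/
theorem one_le_hgt (q : ℚ) : 1 ≤ hgt q := by
  unfold hgt
  have : 1 ≤ max q.num.natAbs q.den := le_max_of_le_right q.pos
  exact_mod_cast this

/-- `den q ≤ H(q)`. [folklore] -/
theorem den_le_hgt (q : ℚ) : (q.den : ℝ) ≤ hgt q := by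
  unfold hgt; exact_mod_cast le_max_right _ _

/-- `|q| ≤ H(q)`. [folklore] -/
theorem abs_le_hgt (q : ℚ) : |(q : ℝ)| ≤ hgt q := by
  have h1 : |(q : ℝ)| = (q.num.natAbs : ℝ) / q.den := by
    rw [← Rat.num_div_den q]
    push_cast
    rw [abs_div, Nat.cast_natAbs, Int.cast_abs, abs_of_pos (show (0 : ℝ) < q.den by exact_mod_cast q.pos)]
    simp [Rat.num_div_den]
  rw [h1]
  have hden : (1 : ℝ) ≤ q.den := by exact_mod_cast q.pos
  calc (q.num.natAbs : ℝ) / q.den ≤ (q.num.natAbs : ℝ) / 1 :=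
        div_le_div_of_nonneg_left (by positivity) one_pos hden
    _ = q.num.natAbs := div_one _
    _ ≤ hgt q := by unfold hgt; exact_mod_cast le_max_left _ _

/-- `max(1, |q|) ≤ H(q)`. [folklore] -/
theorem max_one_abs_le_hgt (q : ℚ) : max 1 |(q : ℝ)| ≤ hgt q :=
  max_le (one_le_hgt q) (abs_le_hgt q)

/-- `max(1, √q) ≤ H(q)`. [folklore] -/
theorem max_one_sqrt_le_hgt (q : ℚ) : max 1 (Real.sqrt (q : ℝ)) ≤ hgt q := by
  refine max_le (one_le_hgt q) ?_
  rcases le_or_gt (q : ℝ) 1 with h | h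
  · exact (Real.sqrt_le_one.mpr h).trans (one_le_hgt q) |>.trans' le_rfl
  · have hq0 : (0 : ℝ) ≤ q := by linarith
    calc Real.sqrt (q : ℝ) ≤ (q : ℝ) := by
          rw [Real.sqrt_le_left (by linarith)]; nlinarith
      _ ≤ |(q : ℝ)| := le_abs_self _
      _ ≤ hgt q := abs_le_hgt q

/-- `1 ≤ P(α)`. [folklore] -/
theorem one_le_heightProd (α : Fin k → ℚ) : 1 ≤ heightProd α :=
  one_le_prod_of_one_le _ _ fun j _ => one_le_hgt (α j)

/-- `∏ⱼ max(1, |αⱼ|) ≤ P(α)`. [folklore] -/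
theorem prod_max_one_abs_le (α : Fin k → ℚ) : ∏ j, max 1 |(α j : ℝ)| ≤ heightProd α :=
  Finset.prod_le_prod (fun j _ => by positivity) fun j _ => max_one_abs_le_hgt (α j)

/-- `∏ⱼ max(1, √αⱼ) ≤ P(α)`. [folklore] -/
theorem prod_max_one_sqrt_le (α : Fin k → ℚ) : ∏ j, max 1 (Real.sqrt (α j : ℝ)) ≤ heightProd α :=
  Finset.prod_le_prod (fun j _ => by positivity) fun j _ => max_one_sqrt_le_hgt (α j)

/-- `∏ⱼ den αⱼ ≤ P(α)`. [folklore] -/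
theorem prod_den_le (α : Fin k → ℚ) : ((∏ j, (α j).den : ℕ) : ℝ) ≤ heightProd α := by
  push_cast
  exact Finset.prod_le_prod (fun j _ => by positivity) fun j _ => den_le_hgt (α j)

/-! ### Passing from `k + 1` to `k` generators -/

/-- The coefficients of the monomials WITHOUT `√αₖ`. [folklore] -/
def lo (c : Finset (Fin (k + 1)) → ℚ) : Finset (Fin k) → ℚ := fun S => c (S.map Fin.castSuccEmb)

/-- The coefficients of the monomials WITH `√αₖ`. [folklore] -/
def hi (c : Finset (Fin (k + 1)) → ℚ) : Finset (Fin k) → ℚ :=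
  fun S => c (insert (Fin.last k) (S.map Fin.castSuccEmb))

/-- The conjugate vector: change the sign of the coefficients of the monomials containing `√αₖ`. [folklore] -/
def conjLast (c : Finset (Fin (k + 1)) → ℚ) : Finset (Fin (k + 1)) → ℚ :=
  fun S => if Fin.last k ∈ S then -c S else c S

/-- `Fin.last k ∉ S.map castSucc`. [folklore] -/
theorem last_not_mem_map (S : Finset (Fin k)) : Fin.last k ∉ S.map Fin.castSuccEmb := by
  simp only [Finset.mem_map, not_exists, not_and]
  intro j _ h
  exact (Fin.castSucc_lt_last j).ne h

/-- **Splitting a sum over the subsets of `Fin (k+1)`** according to `Fin.last k`. [folklore] -/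
theorem sum_finset_succ {M : Type*} [AddCommMonoid M] (g : Finset (Fin (k + 1)) → M) :
    ∑ S, g S = ∑ S : Finset (Fin k), g (S.map Fin.castSuccEmb) +
      ∑ S : Finset (Fin k), g (insert (Fin.last k) (S.map Fin.castSuccEmb)) := by
  classical
  have h1 : (univ : Finset (Finset (Fin (k + 1)))) = (univ : Finset (Fin (k + 1))).powerset :=
    (Finset.powerset_univ).symm
  rw [h1, Fin.univ_castSuccEmb, Finset.cons_eq_insert,
    Finset.sum_powerset_insert (by simp) g]
  have hinj : Function.Injective (Finset.image (Fin.castSuccEmb (n := k))) :=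
    Finset.image_injective Fin.castSuccEmb.injective
  have h2 : ∀ g' : Finset (Fin (k + 1)) → M,
      ∑ t ∈ ((univ : Finset (Fin k)).map Fin.castSuccEmb).powerset, g' t =
        ∑ S : Finset (Fin k), g' (S.map Fin.castSuccEmb) := by
    intro g'
    rw [Finset.map_eq_image, Finset.powerset_image, Finset.sum_image (fun x _ y _ h => hinj h),
      Finset.powerset_univ]
    refine Finset.sum_congr rfl fun S _ => ?_
    rw [Finset.map_eq_image]
  rw [h2 g, h2 (fun t => g (insert (Fin.last k) t))]

variable (α' : Fin (k + 1) → ℚ)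

/-- The first `k` generators. [folklore] -/
abbrev init : Fin k → ℚ := fun j => α' (Fin.castSucc j)

/-- Monomials without the last generator. [folklore] -/
theorem mono_map (S : Finset (Fin k)) : mono α' (S.map Fin.castSuccEmb) = mono (init α') S := by
  unfold mono init
  rw [Finset.prod_map]
  rfl

/-- Monomials with the last generator: `mono (insert last S) = √αₖ · mono S`. [folklore] -/
theorem mono_insert (S : Finset (Fin k)) :
    mono α' (insert (Fin.last k) (S.map Fin.castSuccEmb)) =
      Real.sqrt (α' (Fin.last k) : ℝ) * mono (init α') S := by
  rw [← mono_map α' S]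
  unfold mono
  rw [Finset.prod_insert (last_not_mem_map S)]

/-- **`ev α' c = ev α (lo c) + √αₖ · ev α (hi c)`.** [folklore] -/
theorem ev_succ (c : Finset (Fin (k + 1)) → ℚ) :
    ev α' c = ev (init α') (lo c) + Real.sqrt (α' (Fin.last k) : ℝ) * ev (init α') (hi c) := by
  unfold ev
  rw [sum_finset_succ, Finset.mul_sum]
  congr 1
  · refine Finset.sum_congr rfl fun S _ => ?_
    rw [mono_map]; rfl
  · refine Finset.sum_congr rfl fun S _ => ?_
    rw [mono_insert]; unfold hi; ring

/-- `lo (conjLast c) = lo c`. [folklore] -/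
theorem lo_conjLast (c : Finset (Fin (k + 1)) → ℚ) : lo (conjLast c) = lo c := by
  funext S; unfold lo conjLast; rw [if_neg (last_not_mem_map S)]

/-- `hi (conjLast c) = −hi c`. [folklore] -/
theorem hi_conjLast (c : Finset (Fin (k + 1)) → ℚ) : hi (conjLast c) = -hi c := by
  funext S; unfold hi conjLast; rw [if_pos (Finset.mem_insert_self _ _)]; rfl

/-- `ev α' (conjLast c) = ev α (lo c) − √αₖ · ev α (hi c)`. [folklore] -/
theorem ev_conjLast (c : Finset (Fin (k + 1)) → ℚ) :
    ev α' (conjLast c) = ev (init α') (lo c) - Real.sqrt (α' (Fin.last k) : ℝ) * ev (init α') (hi c) := by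
  rw [ev_succ, lo_conjLast, hi_conjLast]
  have : ev (init α') (-hi c) = -ev (init α') (hi c) := by
    have h := ev_sub (init α') 0 (hi c)
    rw [zero_sub, ev_zero, zero_sub] at h
    exact h
  rw [this]; ring

/-- `conjLast c ≠ 0` for `c ≠ 0`. [folklore] -/
theorem conjLast_ne_zero {c : Finset (Fin (k + 1)) → ℚ} (hc : c ≠ 0) : conjLast c ≠ 0 := by
  intro h
  apply hc
  funext S
  have := congrFun h S
  unfold conjLast at this
  split_ifs at this with hS
  · simpa using this
  · simpa using this

/-- `∑_{S'} |c S'| = ∑_S |lo c S| + ∑_S |hi c S|`. [folklore] -/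
theorem sum_abs_succ (c : Finset (Fin (k + 1)) → ℚ) :
    ∑ S, |(c S : ℝ)| = ∑ S, |(lo c S : ℝ)| + ∑ S, |(hi c S : ℝ)| :=
  sum_finset_succ (fun S => |(c S : ℝ)|)

/-- A non-zero vector has `lo c ≠ 0` or `hi c ≠ 0`. [folklore] -/
theorem lo_hi_ne_zero {c : Finset (Fin (k + 1)) → ℚ} (hc : c ≠ 0) : lo c ≠ 0 ∨ hi c ≠ 0 := by
  by_contra h
  push Not at h
  obtain ⟨hlo, hhi⟩ := h
  apply hc
  have hsum : ∑ S, |(c S : ℝ)| = 0 := by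
    rw [sum_abs_succ, hlo, hhi]; simp
  funext S
  have h0 := (Finset.sum_eq_zero_iff_of_nonneg fun S _ => abs_nonneg (c S : ℝ)).mp hsum S (Finset.mem_univ S)
  have : (c S : ℝ) = 0 := abs_eq_zero.mp h0
  exact_mod_cast this

/-! ### Non-vanishing from the independence of the square classes -/

/-- Under the `2`-Kummer condition (no non-empty sub-product of the positive rationals `αⱼ` is a
square) a non-zero coefficient vector has a non-zero evaluation.
[cite: CijsouwWaldschmidt1977, p. 189] -/
theorem ev_ne_zero (α : Fin k → ℚ) (hα : ∀ j, 0 ≤ α j)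
    (hind : ∀ T : Finset (Fin k), T.Nonempty → ¬ IsSquare (∏ j ∈ T, α j))
    {c : Finset (Fin k) → ℚ} (hc : c ≠ 0) : ev α c ≠ 0 := by
  intro h0
  apply hc
  have hli := Literature.Barriers.ABC.linearIndependent_prod_sqrt α hα hind
  rw [linearIndependent_iff'] at hli
  have h0' : ∑ S ∈ (univ : Finset (Finset (Fin k))), c S • (∏ j ∈ S, Real.sqrt (α j : ℝ)) = 0 := by
    rw [← h0]; unfold ev mono
    refine Finset.sum_congr rfl fun S _ => ?_
    rw [Rat.smul_def]
  funext S
  exact hli univ c h0' S (Finset.mem_univ S)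

/-- Independence of the square classes passes to the first `k` generators. [folklore] -/
theorem hind_init (hind : ∀ T : Finset (Fin (k + 1)), T.Nonempty → ¬ IsSquare (∏ j ∈ T, α' j))
    (T : Finset (Fin k)) (hT : T.Nonempty) : ¬ IsSquare (∏ j ∈ T, init α' j) := by
  have h := hind (T.map Fin.castSuccEmb) (by simpa using hT)
  rwa [Finset.prod_map] at h

/-! ### The Liouville inequality -/

/-- The numerical step of the induction. [folklore] -/
theorem numeric_step {D M H P y z x : ℝ} {E : ℕ} (hD : 1 ≤ D) (hM : 1 ≤ M) (hH : 1 ≤ H)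
    (hP : 1 ≤ P) (hE : 1 ≤ E)
    (hy : 1 / (4 * D ^ 2 * M ^ 2 * H ^ 2 * P ^ 3) ^ E ≤ y) (hz : 0 < z) (hzle : z ≤ H * M * P)
    (hxyz : y ≤ x * z) : 1 / (2 * D * M * (P * H)) ^ (4 * E) ≤ x := by
  set A : ℝ := 4 * D ^ 2 * M ^ 2 * H ^ 2 * P ^ 3 with hA
  have hD2 : 1 ≤ D ^ 2 := one_le_pow₀ hD
  have hM2 : 1 ≤ M ^ 2 := one_le_pow₀ hM
  have hH2 : 1 ≤ H ^ 2 := one_le_pow₀ hH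
  have hP3 : 1 ≤ P ^ 3 := one_le_pow₀ hP
  have hQ1 : 1 ≤ 4 * D ^ 2 * M ^ 2 * H ^ 2 := by
    have := one_le_mul_of_one_le_of_one_le (one_le_mul_of_one_le_of_one_le hD2 hM2) hH2
    linarith
  have hA1 : 1 ≤ A := by rw [hA]; exact one_le_mul_of_one_le_of_one_le hQ1 hP3
  have hAE : 0 < A ^ E := by positivity
  -- `x ≥ y / z ≥ 1 / (A^E z)`
  have hx : 1 / (A ^ E * z) ≤ x := by
    rw [div_le_iff₀ (by positivity)]
    have h1 : 1 / A ^ E ≤ x * z := hy.trans hxyz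
    calc (1 : ℝ) = 1 / A ^ E * A ^ E := by field_simp
      _ ≤ x * z * A ^ E := mul_le_mul_of_nonneg_right h1 hAE.le
      _ = x * (A ^ E * z) := by ring
  refine le_trans ?_ hx
  -- `A^E z ≤ ((2DMPH)^4)^E`
  set Q : ℝ := 4 * D ^ 2 * M ^ 2 * H ^ 2 * P with hQ
  have hQ1' : 1 ≤ Q := by rw [hQ]; exact one_le_mul_of_one_le_of_one_le hQ1 hP
  have h14 : 1 ≤ 4 * D ^ 2 * M * H := by
    have := one_le_mul_of_one_le_of_one_le (one_le_mul_of_one_le_of_one_le hD2 hM) hH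
    linarith
  have hz2 : z ≤ Q ^ E := by
    have h1 : H * M * P ≤ Q := by
      calc H * M * P = (H * M * P) * 1 := by ring
        _ ≤ (H * M * P) * (4 * D ^ 2 * M * H) := mul_le_mul_of_nonneg_left h14 (by positivity)
        _ = Q := by rw [hQ]; ring
    have h2 : Q ≤ Q ^ E := by
      calc Q = Q ^ 1 := (pow_one _).symm
        _ ≤ Q ^ E := pow_le_pow_right₀ hQ1' hE
    exact hzle.trans (h1.trans h2)
  have hB : A ^ E * z ≤ (2 * D * M * (P * H)) ^ (4 * E) := by
    calc A ^ E * z ≤ A ^ E * Q ^ E := mul_le_mul_of_nonneg_left hz2 hAE.le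
      _ = (A * Q) ^ E := (mul_pow _ _ _).symm
      _ = ((2 * D * M * (P * H)) ^ 4) ^ E := by congr 1; rw [hA, hQ]; ring
      _ = (2 * D * M * (P * H)) ^ (4 * E) := by rw [← pow_mul]
  have hpos : 0 < A ^ E * z := by positivity
  exact one_div_le_one_div_of_le hpos hB

set_option maxHeartbeats 800000 in
/-- **Cijsouw–Waldschmidt's Lemma 10 over `ℚ` (a Liouville inequality in `ℚ(√α₁, …, √αₖ)`).**
If the positive rationals `αⱼ` have `𝔽₂`-independent square classes, `c ≠ 0`, `D c_S ∈ ℤ` for all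
`S` and `∑ |c_S| ≤ M` (`D, M ≥ 1`), then
`|∑_S c_S ∏_{j∈S} √αⱼ| ≥ (2 D M ∏ⱼ max(|num αⱼ|, den αⱼ))^{-4^{k+1}}`.
[cite: CijsouwWaldschmidt1977, Lemma 10 (p. 188)] -/
theorem abs_ev_ge : ∀ (k : ℕ) (α : Fin k → ℚ), (∀ j, 0 < α j) →
    (∀ T : Finset (Fin k), T.Nonempty → ¬ IsSquare (∏ j ∈ T, α j)) →
    ∀ (c : Finset (Fin k) → ℚ), c ≠ 0 → ∀ (D : ℕ), 1 ≤ D → (∀ S, ∃ z : ℤ, (D : ℚ) * c S = z) →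
    ∀ (M : ℝ), 1 ≤ M → ∑ S, |(c S : ℝ)| ≤ M →
    1 / (2 * D * M * heightProd α) ^ (4 ^ (k + 1)) ≤ |ev α c| := by
  intro k
  induction k with
  | zero =>
    intro α hα hind c hc D hD hden M hM hcM
    -- `ev α c = c ∅`, a non-zero rational with denominator `≤ D`
    have huniv : (univ : Finset (Finset (Fin 0))) = {∅} := by
      ext S
      simp only [Finset.mem_univ, Finset.mem_singleton, true_iff]
      exact Finset.eq_empty_of_isEmpty S
    have hev : ev α c = (c ∅ : ℝ) := by
      unfold ev
      rw [huniv, Finset.sum_singleton]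
      unfold mono
      rw [Finset.prod_empty, mul_one]
    have hc0 : c ∅ ≠ 0 := by
      intro h; apply hc; funext S
      have : S = ∅ := Finset.eq_empty_of_isEmpty S
      rw [this, h]; rfl
    obtain ⟨z, hz⟩ := hden ∅
    have hz0 : z ≠ 0 := by
      rintro rfl
      rw [Int.cast_zero, mul_eq_zero] at hz
      rcases hz with h | h
      · exact absurd (by exact_mod_cast h : D = 0) (by omega)
      · exact hc0 h
    have hz1 : (1 : ℝ) ≤ |(z : ℝ)| := by exact_mod_cast Int.one_le_abs hz0
    have hD0 : (0 : ℝ) < D := by exact_mod_cast hD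
    have hcz : (c ∅ : ℝ) = z / D := by
      have : ((D : ℚ) * c ∅ : ℚ) = (z : ℚ) := hz
      have h' : (D : ℝ) * (c ∅ : ℝ) = z := by exact_mod_cast this
      field_simp; linarith
    rw [hev, hcz, abs_div, abs_of_pos hD0]
    have hP : heightProd α = 1 := by unfold heightProd; simp
    rw [hP, mul_one]
    have hD1 : (1 : ℝ) ≤ D := by exact_mod_cast hD
    have hDM : (D : ℝ) ≤ (2 * D * M) ^ (4 ^ (0 + 1)) := by
      have hDM1 : (D : ℝ) ≤ D * M := le_mul_of_one_le_right hD0.le hM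
      have h1 : (D : ℝ) ≤ 2 * D * M := by linarith
      have h2 : (1 : ℝ) ≤ 2 * D * M := by linarith
      calc (D : ℝ) ≤ (2 * D * M) ^ 1 := by rw [pow_one]; exact h1
        _ ≤ (2 * D * M) ^ (4 ^ (0 + 1)) := pow_le_pow_right₀ h2 (by norm_num)
    calc 1 / (2 * ↑D * M) ^ 4 ^ (0 + 1) ≤ 1 / (D : ℝ) := one_div_le_one_div_of_le hD0 hDM
      _ ≤ |(z : ℝ)| / D := by rw [le_div_iff₀ hD0]; field_simp; exact hz1
  | succ k ih =>
    intro α' hα' hind c hc D hD hden M hM hcM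
    have hα'0 : ∀ j, 0 ≤ α' j := fun j => (hα' j).le
    set a : ℚ := α' (Fin.last k) with ha
    set α : Fin k → ℚ := init α' with hαdef
    have hα : ∀ j, 0 < α j := fun j => hα' _
    have hα0 : ∀ j, 0 ≤ α j := fun j => (hα j).le
    have hindα : ∀ T : Finset (Fin k), T.Nonempty → ¬ IsSquare (∏ j ∈ T, α j) := hind_init α' hind
    set H : ℝ := hgt a with hH
    set P : ℝ := heightProd α with hP
    have hH1 : 1 ≤ H := one_le_hgt a
    have hP1 : 1 ≤ P := one_le_heightProd α
    have hP' : heightProd α' = P * H := by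
      rw [hP, hH, ha]; unfold heightProd; rw [Fin.prod_univ_castSucc]
    have hD1 : (1 : ℝ) ≤ D := by exact_mod_cast hD
    set u : ℝ := ev α (lo c) with hu
    set v : ℝ := ev α (hi c) with hv
    set r : ℝ := Real.sqrt (a : ℝ) with hr
    have ha0 : (0 : ℝ) ≤ a := by exact_mod_cast hα'0 (Fin.last k)
    have hr0 : 0 ≤ r := Real.sqrt_nonneg _
    have hrr : r * r = a := Real.mul_self_sqrt ha0
    have hx : ev α' c = u + r * v := ev_succ α' c
    -- sums of the parts
    have hsum := sum_abs_succ c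
    have hlo_le : ∑ S, |(lo c S : ℝ)| ≤ M := by
      have : 0 ≤ ∑ S, |(hi c S : ℝ)| := Finset.sum_nonneg fun S _ => abs_nonneg _
      linarith
    have hhi_le : ∑ S, |(hi c S : ℝ)| ≤ M := by
      have : 0 ≤ ∑ S, |(lo c S : ℝ)| := Finset.sum_nonneg fun S _ => abs_nonneg _
      linarith
    have hden_lo : ∀ S, ∃ z : ℤ, (D : ℚ) * lo c S = z := fun S => hden _
    have hden_hi : ∀ S, ∃ z : ℤ, (D : ℚ) * hi c S = z := fun S => hden _
    -- exponent bookkeeping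
    have hE : 4 ^ (k + 1 + 1) = 4 * 4 ^ (k + 1) := by ring
    rcases eq_or_ne (hi c) 0 with hhi0 | hhi0
    · -- no `√αₖ`: the induction hypothesis for `lo c`
      have hlo0 : lo c ≠ 0 := (lo_hi_ne_zero hc).resolve_right (fun h => h hhi0)
      have key := ih α hα hindα (lo c) hlo0 D hD hden_lo M hM hlo_le
      have hv0 : v = 0 := by rw [hv, hhi0, ev_zero]
      have hx' : ev α' c = u := by rw [hx, hv0]; ring
      rw [hx']
      refine le_trans ?_ key
      rw [hP']
      have hb1 : (1 : ℝ) ≤ 2 * D * M * P := by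
        have := one_le_mul_of_one_le_of_one_le (one_le_mul_of_one_le_of_one_le hD1 hM) hP1
        nlinarith
      have hb : 2 * (D : ℝ) * M * P ≤ 2 * D * M * (P * H) := by
        have : 2 * (D : ℝ) * M * P * 1 ≤ 2 * D * M * P * H :=
          mul_le_mul_of_nonneg_left hH1 (by positivity)
        linarith
      apply one_div_le_one_div_of_le (by positivity)
      calc (2 * (D : ℝ) * M * P) ^ 4 ^ (k + 1) ≤ (2 * D * M * (P * H)) ^ 4 ^ (k + 1) :=
            pow_le_pow_left₀ (by positivity) hb _
        _ ≤ (2 * D * M * (P * H)) ^ 4 ^ (k + 1 + 1) :=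
            pow_le_pow_right₀ (hb1.trans hb) (Nat.pow_le_pow_right (by norm_num) (by omega))
    · -- the conjugate and the norm
      set c'' : Finset (Fin k) → ℚ := cmul α (lo c) (lo c) - a • cmul α (hi c) (hi c) with hc''
      have hev'' : ev α c'' = u * u - (a : ℝ) * (v * v) := by
        rw [hc'', ev_sub, ev_smul, ev_cmul α hα0, ev_cmul α hα0]
      have hxbar : ev α' (conjLast c) = u - r * v := ev_conjLast α' c
      have hxbar0 : ev α' (conjLast c) ≠ 0 := ev_ne_zero α' hα'0 hind (conjLast_ne_zero hc)
      have hx0 : ev α' c ≠ 0 := ev_ne_zero α' hα'0 hind hc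
      have hnorm : ev α' c * ev α' (conjLast c) = ev α c'' := by
        rw [hx, hxbar, hev'', ← hrr]; ring
      have hc''0 : c'' ≠ 0 := by
        intro h0
        have : ev α c'' = 0 := by rw [h0, ev_zero]
        rw [← hnorm] at this
        rcases mul_eq_zero.mp this with h | h
        · exact hx0 h
        · exact hxbar0 h
      -- denominators and sizes of `c''`
      set Dd : ℕ := D * D * ∏ j, (α j).den with hDd
      set D'' : ℕ := Dd * a.den with hD''
      have hden'' : ∀ U, ∃ z : ℤ, (D'' : ℚ) * c'' U = z := by
        intro U
        obtain ⟨z₁, hz₁⟩ := exists_int_cmul α (lo c) (lo c) hden_lo hden_lo U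
        obtain ⟨z₂, hz₂⟩ := exists_int_cmul α (hi c) (hi c) hden_hi hden_hi U
        refine ⟨a.den * z₁ - a.num * z₂, ?_⟩
        rw [hc'', hD'']
        simp only [Pi.sub_apply, Pi.smul_apply, smul_eq_mul]
        push_cast
        rw [← hDd] at hz₁ hz₂
        have ha' : (a.den : ℚ) * a = a.num := by rw [mul_comm]; exact Rat.mul_den_eq_num a
        calc ((Dd : ℚ) * a.den) * (cmul α (lo c) (lo c) U - a * cmul α (hi c) (hi c) U)
            = (a.den : ℚ) * ((Dd : ℚ) * cmul α (lo c) (lo c) U) -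
              ((a.den : ℚ) * a) * ((Dd : ℚ) * cmul α (hi c) (hi c) U) := by ring
          _ = (a.den : ℚ) * z₁ - (a.num : ℚ) * z₂ := by rw [hz₁, hz₂, ha']
      have hD''1 : 1 ≤ D'' := by
        rw [hD'', hDd]
        have h1 : 1 ≤ ∏ j, (α j).den := Finset.one_le_prod' fun j _ => (α j).pos
        have := a.pos
        have : 1 ≤ D * D := Nat.one_le_iff_ne_zero.mpr (by positivity)
        exact Nat.one_le_iff_ne_zero.mpr (by positivity)
      have hD''le : (D'' : ℝ) ≤ D ^ 2 * P * H := by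
        rw [hD'', hDd]; push_cast
        have h1 : ((∏ j, ((α j).den : ℝ))) ≤ P := by
          have := prod_den_le α; push_cast at this; exact this
        have h2 : ((a.den : ℝ)) ≤ H := den_le_hgt a
        calc (D : ℝ) * D * (∏ j, ((α j).den : ℝ)) * a.den ≤ (D : ℝ) * D * P * H :=
            mul_le_mul (mul_le_mul_of_nonneg_left h1 (by positivity)) h2 (by positivity) (by positivity)
          _ = (D : ℝ) ^ 2 * P * H := by ring
      set M'' : ℝ := 2 * H * P * M ^ 2 with hM''
      have hPabs : ∏ j, max 1 |(α j : ℝ)| ≤ P := prod_max_one_abs_le α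
      have hc''M : ∑ U, |(c'' U : ℝ)| ≤ M'' := by
        have h1 := l1_cmul_le α (lo c) (lo c)
        have h2 := l1_cmul_le α (hi c) (hi c)
        have hlo2 : (∑ S, |(lo c S : ℝ)|) * ∑ S, |(lo c S : ℝ)| ≤ M ^ 2 := by
          rw [sq]; exact mul_le_mul hlo_le hlo_le (Finset.sum_nonneg fun _ _ => abs_nonneg _) (by linarith)
        have hhi2 : (∑ S, |(hi c S : ℝ)|) * ∑ S, |(hi c S : ℝ)| ≤ M ^ 2 := by
          rw [sq]; exact mul_le_mul hhi_le hhi_le (Finset.sum_nonneg fun _ _ => abs_nonneg _) (by linarith)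
        have hA : ∑ U, |(cmul α (lo c) (lo c) U : ℝ)| ≤ P * M ^ 2 :=
          h1.trans (mul_le_mul hPabs hlo2 (by positivity) (by positivity))
        have hB : ∑ U, |(cmul α (hi c) (hi c) U : ℝ)| ≤ P * M ^ 2 :=
          h2.trans (mul_le_mul hPabs hhi2 (by positivity) (by positivity))
        have haH : |(a : ℝ)| ≤ H := abs_le_hgt a
        calc ∑ U, |(c'' U : ℝ)| ≤ ∑ U, (|(cmul α (lo c) (lo c) U : ℝ)| + |(a : ℝ)| * |(cmul α (hi c) (hi c) U : ℝ)|) := by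
              refine Finset.sum_le_sum fun U _ => ?_
              rw [hc'']
              simp only [Pi.sub_apply, Pi.smul_apply, smul_eq_mul, Rat.cast_sub, Rat.cast_mul]
              calc |(cmul α (lo c) (lo c) U : ℝ) - (a : ℝ) * cmul α (hi c) (hi c) U|
                  ≤ |(cmul α (lo c) (lo c) U : ℝ)| + |(a : ℝ) * cmul α (hi c) (hi c) U| := abs_sub _ _
                _ = _ := by rw [abs_mul]
          _ = ∑ U, |(cmul α (lo c) (lo c) U : ℝ)| + |(a : ℝ)| * ∑ U, |(cmul α (hi c) (hi c) U : ℝ)| := by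
              rw [Finset.sum_add_distrib, Finset.mul_sum]
          _ ≤ P * M ^ 2 + H * (P * M ^ 2) := add_le_add hA (mul_le_mul haH hB (by positivity) (by positivity))
          _ ≤ M'' := by
              have : P * M ^ 2 ≤ H * (P * M ^ 2) := le_mul_of_one_le_left (by positivity) hH1
              rw [hM'']; linarith
      have hM''1 : 1 ≤ M'' := by
        rw [hM'']
        have h1 : 1 ≤ H * P * M ^ 2 :=
          one_le_mul_of_one_le_of_one_le (one_le_mul_of_one_le_of_one_le hH1 hP1) (one_le_pow₀ hM)
        linarith
      -- the induction hypothesis for `c''`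
      have key := ih α hα hindα c'' hc''0 D'' hD''1 hden'' M'' hM''1 hc''M
      -- `|x̄| ≤ H M P'` with `P' = ∏ max(1, √αⱼ) ≤ P`
      have hPs : ∏ j, max 1 (Real.sqrt (α j : ℝ)) ≤ P := prod_max_one_sqrt_le α
      have hxbar_le : |ev α' (conjLast c)| ≤ H * M * P := by
        rw [hxbar]
        have hu_le : |u| ≤ (∑ S, |(lo c S : ℝ)|) * P :=
          (abs_ev_le α (lo c)).trans (mul_le_mul_of_nonneg_left hPs (Finset.sum_nonneg fun _ _ => abs_nonneg _))
        have hv_le : |v| ≤ (∑ S, |(hi c S : ℝ)|) * P :=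
          (abs_ev_le α (hi c)).trans (mul_le_mul_of_nonneg_left hPs (Finset.sum_nonneg fun _ _ => abs_nonneg _))
        have hrH : r ≤ H := (le_max_right 1 r).trans (max_one_sqrt_le_hgt a)
        have h0lo : 0 ≤ ∑ S, |(lo c S : ℝ)| := Finset.sum_nonneg fun _ _ => abs_nonneg _
        have h0hi : 0 ≤ ∑ S, |(hi c S : ℝ)| := Finset.sum_nonneg fun _ _ => abs_nonneg _
        calc |u - r * v| ≤ |u| + |r * v| := abs_sub _ _
          _ = |u| + r * |v| := by rw [abs_mul, abs_of_nonneg hr0]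
          _ ≤ (∑ S, |(lo c S : ℝ)|) * P + r * ((∑ S, |(hi c S : ℝ)|) * P) :=
              add_le_add hu_le (mul_le_mul_of_nonneg_left hv_le hr0)
          _ ≤ H * ((∑ S, |(lo c S : ℝ)|) * P) + H * ((∑ S, |(hi c S : ℝ)|) * P) := by
              apply add_le_add
              · exact le_mul_of_one_le_left (by positivity) hH1
              · exact mul_le_mul_of_nonneg_right hrH (by positivity)
          _ = H * P * (∑ S, |(c S : ℝ)|) := by rw [hsum]; ring
          _ ≤ H * P * M := mul_le_mul_of_nonneg_left hcM (by positivity)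
          _ = H * M * P := by ring
      -- assemble
      have hy : 1 / (4 * (D : ℝ) ^ 2 * M ^ 2 * H ^ 2 * P ^ 3) ^ 4 ^ (k + 1) ≤ |ev α c''| := by
        refine le_trans ?_ key
        apply one_div_le_one_div_of_le (by positivity)
        apply pow_le_pow_left₀ (by positivity)
        calc 2 * (D'' : ℝ) * M'' * P ≤ 2 * ((D : ℝ) ^ 2 * P * H) * (2 * H * P * M ^ 2) * P := by
              rw [hM'']
              apply mul_le_mul_of_nonneg_right _ (by positivity)
              apply mul_le_mul_of_nonneg_right _ (by positivity)
              exact mul_le_mul_of_nonneg_left hD''le (by norm_num)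
          _ = 4 * (D : ℝ) ^ 2 * M ^ 2 * H ^ 2 * P ^ 3 := by ring
      have hxyz : |ev α c''| ≤ |ev α' c| * |ev α' (conjLast c)| := by
        rw [← abs_mul, hnorm]
      rw [hP', hE]
      exact numeric_step hD1 hM hH1 hP1 (Nat.one_le_pow _ _ (by norm_num)) hy
        (abs_pos.mpr hxbar0) hxbar_le hxyz

end Literature.NumberTheory.Transcendental.CW77
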